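import Summits.BirchSwinnertonDyer.BirchSwinnertonDyer.Theorems.UniversalToricDescentSelmerResidualDualityCount
import Literature.NumberTheory.EllipticCurves.IwasawaSelmerIsTorsionProofs
import HarnessLib

/-!
# K2_res from `rank_Λ X ≤ 1` and `μ(X_tors) = 0`

Support file for crux `stmt-BirchSwinnertonDyer-24737` (`TwinAlgMuZeroAtThree`, line `beta-road`, stub K2_res ∣ β), completing
E7 + E8 of the LEAD's STUB BRIEF in the RANK-AT-MOST-ONE form (the rank-zero case is the finite residual quotient of a torsion module
with `μ = 0`): if `X(E/K_∞)` is finitely generated over `Λ` with `rank_Λ X ≤ 1` and `μ(X_tors) = 0`, then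
`#{s ∈ Sel_{p^∞}(E/K_∞) : p s = 0, conj_{γ^{pⁿ}} s = s} ≤ p^{pⁿ + C}` for some `C` and all `n`
(`natCard_setOf_pTorsion_conj_le_of_rank_le_one`). This is EXACTLY the currency of K2_res: by g21's μ-criterion
(`…ResidualCorankOneCriterion`) the bound conversely forces `μ(X_tors) = 0` when `X` is not torsion, and `rank ≤ 1` is the
residual corank-one content — so the research stub of the line is now the structure statement «`rank_Λ X ≤ 1 ∧ μ(X_tors) = 0`»
(Howard 2004 Thm. B-shape), see the v8 skeleton.

References: Washington §13.2; Greenberg, LNM 1716, §1; Howard, Compos. Math. 140 (2004), Thm. B / 2.2.10.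
-/

set_option linter.dupNamespace false
set_option autoImplicit false

noncomputable section
open scoped Classical
open PowerSeries

namespace Summit.BirchSwinnertonDyer.BirchSwinnertonDyer.Theorems.UniversalToricDescentSelmerResidualDualityCount

open Literature.NumberTheory.EllipticCurves Literature.NumberTheory.EllipticCurves.IwasawaAlgebra WeierstrassCurve
open Summit.BirchSwinnertonDyer.BirchSwinnertonDyer.Theorems.UniversalToricDescentResidualGrowthOfRankOne

universe u

variable {p : ℕ} [hp : Fact p.Prime]
variable {K : Type u} [Field K] [NumberField K] {W : WeierstrassCurve K} {κ : ZpExtension K p}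
  {γ : Field.absoluteGaloisGroup K} (D : SelmerDualData W κ γ)

/-- **The torsion case**: if `X = D.X` is a finitely generated TORSION `Λ`-module with `μ(X) = 0`, then
`#{s ∈ Sel_{p^∞}(E/K_∞) : p s = 0, conj_{γ^{pⁿ}} s = s} ≤ #(X/pX) < ∞` uniformly in `n`. [cite: Washington1997, §13.2]
[cite: GreenbergLNM1716, §1 (PDF pp. 60–62)] -/
theorem natCard_setOf_pTorsion_conj_le_of_isTorsion [Module.Finite (IwasawaAlgebra p) D.X]
    (hT : Module.IsTorsion (IwasawaAlgebra p) D.X) (hμ : muInvariant p D.X = 0) (n : ℕ) :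
    Finite (D.X ⧸ (augIdealP p • (⊤ : Submodule (IwasawaAlgebra p) D.X))) ∧
      Nat.card {s : W.selmerInfty κ |
          p • s = 0 ∧ W.conjH1 p κ.kerSubgroup (γ ^ p ^ n) (s : W.subgroupH1 p κ.kerSubgroup) = s} ≤
        Nat.card (D.X ⧸ (augIdealP p • (⊤ : Submodule (IwasawaAlgebra p) D.X))) := by
  haveI := finite_quotient_augIdealP_of_muInvariant_eq_zero hT hμ
  have h𝔞J : augIdealP p ≤
      Ideal.span {PowerSeries.C (p : ℤ_[p]), (PowerSeries.X : IwasawaAlgebra p) ^ (p ^ n)} :=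
    Ideal.span_mono (Set.singleton_subset_iff.mpr (Set.mem_insert _ _))
  obtain ⟨-, hle⟩ := finite_and_natCard_quotient_smul_top_mono (M := D.X) h𝔞J
  exact ⟨inferInstance, (natCard_setOf_pTorsion_conj_le_natCard_quotient D n).trans hle⟩

/-- **K2_res from the structure `rank_Λ X ≤ 1`, `μ(X_tors) = 0`.** If `X = X(E/K_∞)` is finitely generated over `Λ` of rank at
most one and the `μ`-invariant of its torsion submodule vanishes, then there is `C` with
`#{s ∈ Sel_{p^∞}(E/K_∞) : p s = 0, conj_{γ^{pⁿ}} s = s} ≤ p^{pⁿ + C}` for every `n` (rank one: E7 + E8; rank zero: the torsion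
case). [cite: GreenbergLNM1716, §1 (PDF pp. 60–62)] [cite: Washington1997, §13.2] [cite: Howard2004HeegnerKolyvagin, Thm. 2.2.10] -/
theorem natCard_setOf_pTorsion_conj_le_of_rank_le_one [Module.Finite (IwasawaAlgebra p) D.X]
    (hrank : Module.rank (IwasawaAlgebra p) D.X ≤ 1)
    (hμ : muInvariant p ↥(Submodule.torsion (IwasawaAlgebra p) D.X) = 0) :
    ∃ C : ℕ, ∀ n : ℕ, Nat.card {s : W.selmerInfty κ |
        p • s = 0 ∧ W.conjH1 p κ.kerSubgroup (γ ^ p ^ n) (s : W.subgroupH1 p κ.kerSubgroup) = s} ≤ p ^ (p ^ n + C) := by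
  rcases eq_or_lt_of_le hrank with h1 | h0
  · exact natCard_setOf_pTorsion_conj_le_of_rank_one D h1 hμ
  · -- rank zero: `X` is torsion, `torsion X = X`, `μ(X) = 0`
    have h0' : Module.rank (IwasawaAlgebra p) D.X = 0 := Cardinal.lt_one_iff.mp h0
    have hT : Module.IsTorsion (IwasawaAlgebra p) D.X := rank_eq_zero_iff_isTorsion.mp h0'
    have htop : Submodule.torsion (IwasawaAlgebra p) D.X = ⊤ :=
      eq_top_iff.mpr fun x _ ↦ (Submodule.mem_torsion_iff x).mpr (@hT x)
    have e : ↥(Submodule.torsion (IwasawaAlgebra p) D.X) ≃ₗ[IwasawaAlgebra p] D.X :=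
      (LinearEquiv.ofEq _ _ htop).trans Submodule.topEquiv
    have hμX : muInvariant p D.X = 0 := by
      rw [← Literature.NumberTheory.EllipticCurves.muInvariant_eq_of_linearEquiv e]; exact hμ
    set c := Nat.card (D.X ⧸ (augIdealP p • (⊤ : Submodule (IwasawaAlgebra p) D.X))) with hc
    refine ⟨c, fun n ↦ ?_⟩
    obtain ⟨-, hle⟩ := natCard_setOf_pTorsion_conj_le_of_isTorsion D hT hμX n
    calc Nat.card {s : W.selmerInfty κ |
            p • s = 0 ∧ W.conjH1 p κ.kerSubgroup (γ ^ p ^ n) (s : W.subgroupH1 p κ.kerSubgroup) = s}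
          ≤ c := hle
      _ ≤ p ^ c := (Nat.lt_pow_self hp.out.one_lt).le
      _ ≤ p ^ (p ^ n + c) := Nat.pow_le_pow_right hp.out.pos (Nat.le_add_left c (p ^ n))

end Summit.BirchSwinnertonDyer.BirchSwinnertonDyer.Theorems.UniversalToricDescentSelmerResidualDualityCount

end
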